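import Literature.NumberTheory.EllipticCurves.Kobayashi2003.SignedColemanKatoZeta
import Literature.NumberTheory.EllipticCurves.Kobayashi2003.SignedSelmerDualUniquenessProofs
import Literature.NumberTheory.EllipticCurves.KatoFineSelmerDualUniquenessProofs
import Literature.NumberTheory.EllipticCurves.Kato2004.IwasawaH1LambdaTorsionFreeProofs
import Literature.NumberTheory.EllipticCurves.IwasawaAlgebraPseudoNullProofs
import Literature.NumberTheory.EllipticCurves.IwasawaAlgebraProofs
import Literature.NumberTheory.EllipticCurves.Kobayashi2003.SignedPAdicLFunctionExistenceProofs
import Literature.NumberTheory.EllipticCurves.SupersingularIrreducibleProofs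
import Literature.NumberTheory.EllipticCurves.SerreOpenImageOrdinaryInertiaProofs
import Literature.NumberTheory.EllipticCurves.Rank1Residual.PeriodUnitProofs
import HarnessLib

/-!
# Kobayashi 2003, proof of Thm. 7.3 i) (p. 13) — the ASSEMBLY of the `η = 1` Coleman–Kato package
# `thm62_63_73_signedColemanKato_zeta` from Kato's Thm. 12.4 and ONE pair of dual data (proofs only)

Topic `NumberTheory/EllipticCurves`, sub-directory `Kobayashi2003` (namespace = path). A THEOREMS file
(no definition, no structure, no named fact; net Literature debt `0`). Seat
`bsd-input-kob03-signed-ck-zeta` (literature-prover, cell `bsd-inputs`, LADDER «inputs → unconditional»,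
row F8/G63), in support of item stmt-BirchSwinnertonDyer-19002 (`KobayashiMainConjectureSmallImage`,
stub `stub_publishedInputs_ns`, third conjunct). HONEST FRAMING: the package fact
`Kobayashi2003.thm62_63_73_signedColemanKato_zeta` (file `SignedColemanKatoZeta`, size XL: Kato's Euler
system with the explicit reciprocity law, Kobayashi's `±` Coleman maps through Honda theory §8, and
Poitou–Tate along the cyclotomic tower are not tree theorems) is NOT proved here and no `_holds` is
claimed; this file kernel-checks the ONE printed inference of the proof of Thm. 7.3 i) and the transport
of (7.21) between Pontryagin-dual data, so that the residual PRINTED inputs of the package are exactly the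
hypotheses of `nonempty_signedColemanKatoData_of_oneDatum` below (listed in §«Residual inputs»). Proving
them makes the consumer unconditional AS TYPED and nothing more; no statement about
`BirchSwinnertonDyer` is proved by any of this.

## Source, verbatim (S. Kobayashi, *Iwasawa theory for elliptic curves at supersingular primes*, Invent.
## Math. 152 (2003) 1–36 [Kobayashi2003]; held copy `paper:doi-10-1007-s00222-002-0265-4`, p. 13, read
## by this seat 2026-08-28)

"**Theorem 7.3.** i) We have an exact sequence
`0 → 𝐇¹(T) → H¹_Iw(T)/H¹_{Iw,±}(T) → X^±(E/K_∞) → X⁰(E/K_∞) → 0` (7.21). … *Proof.* The exact sequence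
is nothing but (7.20) except for the injectivity of `𝐇¹(T) → H¹_Iw(T)/H¹_{Iw,±}(T)`. We consider the
composition of this map and the even (odd) Coleman map: `𝐇¹(T) → H¹_Iw(T)/H¹_{Iw,±}(T) → Λ` (cf.
Theorem 6.2.) Since `𝐇¹(T)` is a free `Λ`-module of rank 1 (cf. Theorem 5.1 iii)), this morphism is
injective if and only if it is a non-zero map. Hence i) follows from Theorem 6.3 and Rohrlich's theorem
[20], which assures `L_p^±(E, η, X) ≠ 0`." And p. 9: "**Theorem 5.1 (Kato [7]).** … ii) `𝐇¹(T)` is a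
torsion free `Λ`-module, and `𝐇¹(V)` is a free `Λ ⊗ ℚ`-module of rank 1. iii) If `T/pT` is
irreducible … then `𝐇¹(T)` is a free `Λ`-module of rank 1. *Proof.* See Kato [7], Theorem 12.4."

## What is proved (every step a printed statement or a tree theorem)

* `injective_of_rank_le_one_of_ne_zero` — the module algebra of the displayed inference, in the form
  the tree can feed: over a domain `R`, a NON-ZERO `R`-linear map `c : M → R` on a module `M` WITHOUT
  zero smul-divisors and of `R`-rank `≤ 1` is injective (two elements of `M` are dependent; apply `c`).
  Kobayashi uses "free of rank 1" (Thm. 5.1 iii)); torsion free of rank `≤ 1` (Thm. 5.1 ii) = Kato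
  Thm. 12.4 (2)) suffices, and torsion-freeness of the PINNED `𝐇¹_Γ(T_pW)` is a tree THEOREM
  (`Kato2004.IwasawaH1Data.noZeroSMulDivisors`, file `Kato2004/IwasawaH1LambdaTorsionFreeProofs`), so
  only the RANK clause of the named fact `Kato2004.thm12_4` is consumed below.
* `exists_exact_of_linearEquiv` — transport of «`H →ᶜ Λ →ʲ X →ᵏ Y → 0` exact» along `Λ`-isomorphisms
  `X ≃ X'`, `Y ≃ Y'` (Mathlib's `LinearEquiv.conj_exact_iff_exact` / `postcomp_exact_iff_exact`).
* `nonempty_signedColemanKatoData_of_oneDatum` — PIN LEVEL: for a pin `I : IwasawaH1Data W p κ γ` with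
  `γ` a topological generator and `rank_Λ I.H ≤ 1`, a `Λ`-linear `col : I.H → Λ` and a submodule `Z`
  carrying the span clause and the localized image clause of the package VERBATIM, SOME `z ∈ Z` with
  `col z ≠ 0` («`Col^±(z^±) = L_p^±(E, X) ≠ 0`», Thm. 6.3 with Rohrlich [20]), and (7.20)/(7.21)-shaped
  exactness `I.H →^{col} Λ → D₀.X → Y₀.X → 0` for ONE signed dual datum `D₀` and ONE fine dual datum
  `Y₀`, the structure `SignedColemanKatoData W p f ϖ κ γ ε I` is inhabited: `col` is injective by the
  first lemma, and exactness holds for EVERY pair `(D, Y)` because any two signed (resp. fine) dual data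
  are `Λ`-isomorphic (tree THEOREMS `SignedSelmerDualData.nonempty_linearEquiv`,
  `WeierstrassCurve.FineSelmerDualData.nonempty_linearEquiv`).
* `exists_mem_ne_zero_of_image_zeta_localized` — the nonvanishing input is implied by the image clause
  once `E[p]` is irreducible, a Néron-normalised `G₁ ≠ 0` exists and one height-one prime is named (the
  road «Thm. 6.3 + Rohrlich» read on ideals; recorded so the residual census is exact).
* `thm62_63_73_signedColemanKato_zeta_of_inputs` — FACT LEVEL: the package
  `thm62_63_73_signedColemanKato_zeta` follows from the named fact `Kato2004.thm12_4` (Kato Thm. 12.4,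
  file `Kato2004/IwasawaCohomology`; only its clause `rank_Λ 𝐇¹_Γ = 1` is used) and the displayed
  input `hIn` = the package's own four clauses with (a) `col_injective` REPLACED by the printed
  nonvanishing «some `z ∈ Z` has `col z ≠ 0`» and (b) the exact sequence asked for ONE pair of dual
  data instead of all. Nothing else is assumed; in particular no statement of the package is taken as
  a hypothesis in its own shape (D-0026: no restatement, no smuggling; the theorem is an `_of_` edge,
  not a `_holds`).
* `image_localized_of_map_eq_span` — the READING `Kob03-63-eta1-ideal-localized` of the package made a
  LEMMA: for `Λ`-linear `col : H → Λ` and submodules `Z ≤ Zbig` with `Zbig/Z` FINITE (Kato Thm. 12.6: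
  «`Z ⊂ Z(f,T)` and `Z(f,T)/Z` is a finite group») and `col(Zbig) = (G₁)` (Thm. 6.3 at `η = 1` on
  `Z(T)^Δ`), at every height-one `𝔭` some `s ∉ 𝔭` has `s·G₁ ∈ col(Z)` and `s·col(Z) ⊆ (G₁)` — a finite
  `Λ`-module being pseudo-null (tree theorem `isPseudoNull_of_finite`, file
  `IwasawaAlgebraPseudoNullProofs`). With it: `image_zeta_localized_of_valueForm`,
  `nonempty_signedColemanKatoData_of_valueForm` and the FACT-LEVEL
  `thm62_63_73_signedColemanKato_zeta_of_valueInputs` — the package from `Kato2004.thm12_4` and the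
  input `hVal` in which the localized image clause is REPLACED by its printed source (a submodule
  `Zbig = Z(T)^Δ ≥ Z` of finite index with `col(Zbig) = (L_p^ε)`, under `Irr(E[p])`).
* `thm62_63_73_signedColemanKato_zeta_of_valueInputs_of_periodUnit` — FACT LEVEL, the nonvanishing
  clause DISCHARGED: from `Kato2004.thm12_4`, the two period-unit named facts
  `realPeriodRat_eq_unit_mul_plusPeriod` / `…_three` (Greenberg–Vatsal 2000 §3, Mazur 1978; the SAME
  `h5`/`h3` the 19002 consumer `signedMu_eq_zero_of_hasUnitContent` carries) and the input `hVal'` =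
  `hVal` WITHOUT «some `z ∈ Z` has `col z ≠ 0`»: irreducibility of `E[p]` at an odd supersingular prime
  (tree theorem `hasIrreducibleModPGaloisRep_of_dvd_frobeniusTrace`), Pollack's `L_p^ε ≠ 0` (tree theorem
  `exists_ne_zero_and_isSignedPAdicLFunction`) and `ord_p ϖ = 0` (tree theorem
  `Rank1Residual.padicValRat_periodRatio_eq_zero`) give an integral `G₁ = C(u)·L ≠ 0`, and the value
  identity forces `col ≠ 0` on `Z` at `𝔭 = (p)`. The residual `hVal'` has exactly FOUR printed clauses
  (R1∘R2 as a bare `Λ`-linear map, the span clause, R4 in value form, R3 for one pair).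

## Residual inputs (what `hIn` still asks from print; typed sketches with locators in the seat's evidence
## note on stmt-BirchSwinnertonDyer-19002, file `NEEDS-X-thm62_63_73_signedColemanKato_zeta.md`)

R1 «signed Coleman map on the `Δ`-trivial local Iwasawa cohomology, onto `Λ`» — Thm. 6.2 (6.13)/(6.14)
(p. 11; proved §8 via Honda theory, Prop. 8.12, Lemma 8.15, Thm. 8.23): the tree has the LOCAL functional
model and Sprung's `♯/♭` Coleman predicates (`Sprung2012/ColemanMaps`, `…/LocalIwasawaModule`,
`…/ColemanMapTheorems`: facts `thm22_exists_isHondaSystem`, `prop39_exists_isColemanPair`,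
`prop57_isColemanPair_unique`; injectivity PROVED in `ColemanMapJointInjectiveProofs`), not the
`a_p = 0` identification `Col^♯ = Col^−`, `Col^♭ = Col^+` as a map onto `Λ`. R2 «localisation
`𝐇¹_Γ(T_pW) → H¹_Iw` into that model» — the cup product / local Tate pairing of a global `Λ`-adic
class with local points (Kobayashi §8.1–8.3; Kato §17.4): no tree vocabulary. R3 «Poitou–Tate along the
tower» — (7.17)–(7.20) with Prop. 7.1 i) (Kurihara) (p. 12; Perrin-Riou [16] App. A.3.2): the tree's
Poitou–Tate facts are finite-level for `E[n]` (`GaloisCohomology/PoitouTateSelmerStructures`), not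
`Λ`-adic. R4 «explicit reciprocity» — Thm. 6.3 `Col^±(z) = L_p^±(E, X)` (p. 11, §8.7) on Kato's zeta
class (Kato Thm. 12.5 (1) = Kobayashi Thm. 5.2 i); tree facts `Kato2004.exists_eulerSystem_expStar_values`
with the PROVED lift `Kato2004.isEulerSystemClass_of_zetaBody`), read on ideals at height-one primes with
Kato Thm. 12.6 (finite index). R5 «rank one» — Kato Thm. 12.4 (2), the tree's named fact
`Kato2004.thm12_4` (its torsion-free and finite-generation clauses are tree theorems; `rank = 1` is not).
Nonvanishing (Rohrlich [20] / Pollack Cor. 5.11) is in the tree for the tree's `L`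
(`Kobayashi2003.exists_ne_zero_and_isSignedPAdicLFunction`, unconditional) and is DISCHARGED in §4 modulo
the period-unit facts.

References: [Kobayashi2003] Thm. 5.1 ii)/iii) (p. 9), Remark 5.3 i) (p. 10), Thm. 6.2 (6.13)–(6.14),
Thm. 6.3 (p. 11), (7.17)–(7.20), Prop. 7.1 (p. 12), Thm. 7.3 and its proof (p. 13), Thm. 3.2 (p. 7);
[Kato2004Asterisque] Thm. 12.4 (2)(3) (p. 221), Thm. 12.5–12.6 (p. 222); [Rohrlich1984]; [Pollack2003]
Cor. 5.11; [GreenbergVatsal2000] §3 Remark 3.4; [Mazur1978] Cor. 4.1; tree: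
`Kobayashi2003/{SignedColemanKatoZeta, SignedSelmerDualUniquenessProofs, SignedPAdicLFunctionExistenceProofs}.lean`,
`KatoFineSelmerDualUniquenessProofs.lean`, `Kato2004/{IwasawaCohomology, IwasawaH1LambdaTorsionFreeProofs}.lean`,
`IwasawaAlgebra{PseudoNull,}Proofs.lean`, `SupersingularIrreducibleProofs.lean`, `Rank1Residual/PeriodUnitProofs.lean`.
-/

noncomputable section

open scoped MatrixGroups ModularForm

open CongruenceSubgroup WeierstrassCurve Field Literature.NumberTheory.EllipticCurves
  Literature.NumberTheory.EllipticCurves.ModularForms Literature.NumberTheory.GaloisRepresentations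
  Literature.NumberTheory.EllipticCurves.Kato2004 ZpExtension

namespace Literature.NumberTheory.EllipticCurves.Kobayashi2003

/-! ## §1 The printed inference of the proof of Thm. 7.3 i): on a torsion-free module of rank `≤ 1`, a
linear map to the (integral domain of) scalars is injective iff it is non-zero -/

section ModuleAlgebra

/-- **"Since `𝐇¹(T)` is a free `Λ`-module of rank 1, this morphism is injective if and only if it is a
non-zero map"** (Kobayashi, proof of Thm. 7.3 i), p. 13), in the generality the tree can feed: over an
integral domain `R`, a non-zero `R`-linear map `c : M → R` on a module `M` without zero smul-divisors
(torsion free) and of rank `≤ 1` is injective. Proof: for `x ∈ ker c` and `y` with `c y ≠ 0`, the pair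
`(x, y)` is linearly dependent (`rank ≤ 1`), `s•x + t•y = 0` with `(s, t) ≠ 0`; applying `c` gives
`t·c(y) = 0`, so `t = 0`, `s ≠ 0`, `s•x = 0`, `x = 0`.
[cite: Kobayashi2003, proof of Thm. 7.3 i) (p. 13) with Thm. 5.1 ii)/iii) (p. 9)] -/
theorem injective_of_rank_le_one_of_ne_zero {R M : Type} [CommRing R] [IsDomain R] [AddCommGroup M]
    [Module R M] [NoZeroSMulDivisors R M] (hrank : Module.rank R M ≤ 1) (c : M →ₗ[R] R) (hc : c ≠ 0) :
    Function.Injective c := by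
  obtain ⟨y, hy⟩ := DFunLike.ne_iff.mp hc
  rw [LinearMap.zero_apply] at hy
  rw [injective_iff_map_eq_zero]
  intro x hx
  by_contra hx0
  have hdep : ¬ LinearIndependent R ![x, y] := by
    intro hli
    have h2 : (2 : Cardinal) ≤ Module.rank R M := by simpa using hli.cardinal_le_rank
    exact (not_le.mpr Cardinal.one_lt_two) (h2.trans hrank)
  rw [LinearIndependent.pair_iff] at hdep
  push Not at hdep
  obtain ⟨s, t, hst, hst0⟩ := hdep
  have ht : t = 0 := by
    have h := congrArg c hst
    rw [map_add, map_smul, map_smul, hx, smul_zero, zero_add, map_zero, smul_eq_mul] at h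
    exact (mul_eq_zero.mp h).resolve_right hy
  have hs : s ≠ 0 := fun hs ↦ hst0 hs ht
  rw [ht, zero_smul, add_zero] at hst
  exact hx0 ((smul_eq_zero.mp hst).resolve_left hs)

/-- **Transport of the shape of (7.21) along isomorphisms of the two dual modules**: if
`H →ᶜ A →^{j₀} X₀ →^{k₀} Y₀ → 0` is exact (at `A` and at `X₀`, `k₀` onto) and `e : X₀ ≃ X`,
`e' : Y₀ ≃ Y` are `R`-linear isomorphisms, then `H →ᶜ A →^{e∘j₀} X →^{e'∘k₀∘e⁻¹} Y → 0` is exact. Used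
with the tree's comparison isomorphisms between Pontryagin-dual data (which are unique up to
`Λ`-isomorphism). [cite: Kobayashi2003, Thm. 7.3 i) (7.21) (p. 13) and Def. 1.1 (p. 2)] -/
theorem exists_exact_of_linearEquiv {R : Type*} [CommRing R] {H A X₀ Y₀ X Y : Type*} [AddCommGroup H]
    [Module R H] [AddCommGroup A] [Module R A] [AddCommGroup X₀] [Module R X₀] [AddCommGroup Y₀]
    [Module R Y₀] [AddCommGroup X] [Module R X] [AddCommGroup Y] [Module R Y] (c : H →ₗ[R] A)
    {j₀ : A →ₗ[R] X₀} {k₀ : X₀ →ₗ[R] Y₀} (h₁ : Function.Exact c j₀) (h₂ : Function.Exact j₀ k₀)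
    (h₃ : Function.Surjective k₀) (e : X₀ ≃ₗ[R] X) (e' : Y₀ ≃ₗ[R] Y) :
    ∃ (j : A →ₗ[R] X) (k : X →ₗ[R] Y), Function.Exact c j ∧ Function.Exact j k ∧ Function.Surjective k := by
  refine ⟨(e : X₀ →ₗ[R] X) ∘ₗ j₀, (e' : Y₀ →ₗ[R] Y) ∘ₗ (k₀ ∘ₗ (e.symm : X →ₗ[R] X₀)), ?_, ?_, ?_⟩
  · exact LinearEquiv.postcomp_exact_iff_exact.mpr h₁
  · exact LinearEquiv.postcomp_exact_iff_exact.mpr ((LinearEquiv.conj_exact_iff_exact j₀ k₀ e).mpr h₂)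
  · exact e'.surjective.comp (h₃.comp e.symm.surjective)

/-- **Thm. 6.3 + Kato Thm. 12.6 ⟹ the localized image clause** (the reading
`Kob03-63-eta1-ideal-localized` of the package, now a LEMMA). Let `col : H → Λ` be `Λ`-linear,
`Z ≤ Zbig ≤ H` submodules with `Zbig/Z` FINITE («`Z ⊂ Z(f,T)` and `Z(f,T)/Z` is a finite group», Kato
Thm. 12.6) and `col(Zbig) = (G₁)` as ideals («`Col^±(z) = L_p^±(E, X)`», Thm. 6.3 at `η = 1`, on the
`Λ`-module `Z(T)` generated by the zeta elements, Thm. 5.2 iv)). Then at every height-one prime `𝔭` of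
`Λ = ℤ_p⟦T⟧` some `s ∉ 𝔭` has `s·G₁ ∈ col(Z)` and `s·col(z) ∈ (G₁)` for all `z ∈ Z`: a finite
`Λ`-module is pseudo-null (tree theorem `isPseudoNull_of_finite`), so the class of a preimage
`z₀ ∈ Zbig` of `G₁` in `Zbig/Z` is killed by some `s ∉ 𝔭`.
[cite: Kobayashi2003, Thm. 6.3 (p. 11), Thm. 5.2 iv) (p. 9)] [cite: Kato2004Asterisque, Thm. 12.6 (p. 222)] -/
theorem image_localized_of_map_eq_span {p : ℕ} [Fact p.Prime] {H : Type*} [AddCommGroup H]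
    [Module (IwasawaAlgebra p) H] (col : H →ₗ[IwasawaAlgebra p] IwasawaAlgebra p)
    {Z Zbig : Submodule (IwasawaAlgebra p) H} (hle : Z ≤ Zbig)
    (hfin : Finite (Zbig ⧸ Submodule.comap Zbig.subtype Z)) {G₁ : IwasawaAlgebra p}
    (hval : Submodule.map col Zbig = Ideal.span {G₁}) (𝔭 : PrimeSpectrum (IwasawaAlgebra p))
    (h𝔭 : 𝔭.asIdeal.height = 1) :
    ∃ s : IwasawaAlgebra p, s ∉ 𝔭.asIdeal ∧ s * G₁ ∈ Submodule.map col Z ∧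
      ∀ z ∈ Z, s * col z ∈ Ideal.span {G₁} := by
  have hG : G₁ ∈ Submodule.map col Zbig := hval ▸ Ideal.mem_span_singleton_self G₁
  obtain ⟨z₀, hz₀, hcol⟩ := Submodule.mem_map.mp hG
  haveI := hfin
  have hsub := isPseudoNull_of_finite p (Zbig ⧸ Submodule.comap Zbig.subtype Z) 𝔭 h𝔭.le
  obtain ⟨s, hs, hsz⟩ :=
    LocalizedModule.subsingleton_iff.mp hsub (Submodule.Quotient.mk ⟨z₀, hz₀⟩)
  refine ⟨s, hs, ?_, fun z hz ↦ ?_⟩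
  · rw [← Submodule.Quotient.mk_smul, Submodule.Quotient.mk_eq_zero, Submodule.mem_comap] at hsz
    refine Submodule.mem_map.mpr ⟨s • z₀, hsz, ?_⟩
    rw [map_smul, hcol, smul_eq_mul]
  · have hz' : col z ∈ Ideal.span {G₁} := hval ▸ Submodule.mem_map_of_mem (hle hz)
    exact Ideal.mul_mem_left _ s hz'

end ModuleAlgebra

/-! ## §2 Pin level: the package structure from rank `≤ 1`, the printed nonvanishing and ONE pair of
dual data -/

section Pin

variable {p : ℕ} [Fact p.Prime] {W : WeierstrassCurve ℚ} [W.IsElliptic]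
  [ContinuousSMul ℤ_[p] (W.tateModule p)] [Module.Free ℤ_[p] (W.tateModule p)]
  [Module.Finite ℤ_[p] (W.tateModule p)] {N : ℕ} {f : CuspForm (Gamma0 N) 2} {ϖ : ℚ}
  {κ : ZpExtension ℚ p} {γ : absoluteGaloisGroup ℚ} {ε : ℤˣ}

/-- **Kobayashi's `η = 1` Coleman–Kato package at ONE pin, assembled as in the proof of Thm. 7.3 i)
(p. 13).** Let `I : IwasawaH1Data W p κ γ` (`𝐇¹_Γ(T_pW)`) with `γ` a topological generator of
`Gal(ℚ_∞/ℚ)` and `rank_Λ I.H ≤ 1` (Kato Thm. 12.4 (2) = Kobayashi Thm. 5.1 ii); torsion-freeness is the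
tree theorem `IwasawaH1Data.noZeroSMulDivisors`). Given a `Λ`-linear `col : I.H → Λ` («`Col^ε ∘ loc_p`»,
Thm. 6.2 (6.13)/(6.14) composed with the first arrow of (7.20)), a submodule `Z ≤ I.H` inside the span of
genuine Euler-system classes (Kato Thm. 12.6 / Ex. 13.3) with the localized image clause of the package
(Thm. 6.3 read on ideals) VERBATIM, SOME `z ∈ Z` with `col z ≠ 0` (Thm. 6.3 with Rohrlich [20]:
`Col^±(z^±) = L_p^±(E, X) ≠ 0`), and ONE signed dual datum `D₀` of `Sel^ε(E/ℚ_∞)`, ONE fine dual datum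
`Y₀` of `Sel₀(ℚ_∞, E[p^∞])` and `Λ`-linear `j₀, k₀` with `I.H →^{col} Λ →^{j₀} D₀.X →^{k₀} Y₀.X → 0`
exact ((7.20) with Prop. 7.1 i) and (6.13)/(6.14) composed in), the structure
`SignedColemanKatoData W p f ϖ κ γ ε I` is inhabited: `col` is injective
(`injective_of_rank_le_one_of_ne_zero`), and the exact sequence holds for EVERY pair of dual data by
transport along the comparison isomorphisms `SignedSelmerDualData.nonempty_linearEquiv`,
`FineSelmerDualData.nonempty_linearEquiv`.
[cite: Kobayashi2003, proof of Thm. 7.3 i) (p. 13); Thm. 5.1 ii)/iii) (p. 9); Thm. 6.2 (6.13)–(6.14), Thm. 6.3 (p. 11); (7.20), Prop. 7.1 i) (p. 12)]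
[cite: Kato2004Asterisque, Thm. 12.4 (2) (p. 221), Thm. 12.6 (p. 222), Ex. 13.3 (p. 225)] -/
theorem nonempty_signedColemanKatoData_of_oneDatum (hγ : κ.IsTopGenerator γ)
    (I : Kato2004.IwasawaH1Data W p κ γ) (hrank : Module.rank (IwasawaAlgebra p) I.H ≤ 1)
    (col : I.H →ₗ[IwasawaAlgebra p] IwasawaAlgebra p) (Z : Submodule (IwasawaAlgebra p) I.H)
    (hne : ∃ z ∈ Z, col z ≠ 0)
    (hspan : Z ≤ Submodule.span (IwasawaAlgebra p) {s : I.H | Kato2004.IsEulerSystemClass W p κ γ I s})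
    (himage : W.HasIrreducibleModPGaloisRep p →
      ∀ (L G₁ : IwasawaAlgebra p), IsSignedPAdicLFunction f p ε L →
        iwasawaToPowerSeries p G₁ = PowerSeries.C ((ϖ : ℚ) : ℚ_[p]) * iwasawaToPowerSeries p L →
        ∀ 𝔭 : PrimeSpectrum (IwasawaAlgebra p), 𝔭.asIdeal.height = 1 →
          ∃ s : IwasawaAlgebra p, s ∉ 𝔭.asIdeal ∧
            s * G₁ ∈ Submodule.map col Z ∧
            ∀ z ∈ Z, s * col z ∈ Ideal.span {G₁})
    (D₀ : SignedSelmerDualData W κ γ ε) (Y₀ : W.FineSelmerDualData κ γ)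
    (j₀ : IwasawaAlgebra p →ₗ[IwasawaAlgebra p] D₀.X) (k₀ : D₀.X →ₗ[IwasawaAlgebra p] Y₀.X)
    (h₁ : Function.Exact col j₀) (h₂ : Function.Exact j₀ k₀) (h₃ : Function.Surjective k₀) :
    Nonempty (SignedColemanKatoData W p f ϖ κ γ ε I) := by
  haveI := I.noZeroSMulDivisors hγ
  have hcol : col ≠ 0 := by
    obtain ⟨z, -, hz⟩ := hne
    exact fun h ↦ hz (by rw [h, LinearMap.zero_apply])
  refine ⟨{ col := col
            col_injective := injective_of_rank_le_one_of_ne_zero hrank col hcol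
            Z := Z
            zeta_le_span := hspan
            image_zeta_localized := himage
            exact := fun D Y ↦ ?_ }⟩
  obtain ⟨e⟩ := SignedSelmerDualData.nonempty_linearEquiv D₀ D
  obtain ⟨e'⟩ := WeierstrassCurve.FineSelmerDualData.nonempty_linearEquiv Y₀ Y
  exact exists_exact_of_linearEquiv col h₁ h₂ h₃ e e'

omit [Module.Free ℤ_[p] (W.tateModule p)] [Module.Finite ℤ_[p] (W.tateModule p)] in
/-- **The nonvanishing input from the image clause** («Hence i) follows from Theorem 6.3 and Rohrlich's
theorem», read on ideals): if `E[p]` is irreducible, `L` is the sign-`ε` Pollack function of `f`, an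
INTEGRAL Néron-normalised `G₁ ≠ 0` with `ι G₁ = C(ϖ)·ι L` exists, and `𝔭` is a height-one prime of
`Λ`, then the localized image clause yields some `z ∈ Z` with `col z ≠ 0` (namely `col z = s·G₁`,
`s ∉ 𝔭`). Recorded so that the residual census is exact: the nonvanishing hypothesis of
`nonempty_signedColemanKatoData_of_oneDatum` costs nothing beyond the image clause, irreducibility
(Remark 5.3 i)), `L ≠ 0` (Rohrlich [20] / Pollack Cor. 5.11, tree `exists_isSignedPAdicLFunction`)
and `p`-integrality of `ϖ·L`.
[cite: Kobayashi2003, proof of Thm. 7.3 i) (p. 13); Thm. 6.3 (p. 11); Remark 5.3 i) (p. 10); Thm. 3.2 (p. 7)] -/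
theorem exists_mem_ne_zero_of_image_zeta_localized (I : Kato2004.IwasawaH1Data W p κ γ)
    (col : I.H →ₗ[IwasawaAlgebra p] IwasawaAlgebra p) (Z : Submodule (IwasawaAlgebra p) I.H)
    (himage : W.HasIrreducibleModPGaloisRep p →
      ∀ (L G₁ : IwasawaAlgebra p), IsSignedPAdicLFunction f p ε L →
        iwasawaToPowerSeries p G₁ = PowerSeries.C ((ϖ : ℚ) : ℚ_[p]) * iwasawaToPowerSeries p L →
        ∀ 𝔭 : PrimeSpectrum (IwasawaAlgebra p), 𝔭.asIdeal.height = 1 →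
          ∃ s : IwasawaAlgebra p, s ∉ 𝔭.asIdeal ∧
            s * G₁ ∈ Submodule.map col Z ∧
            ∀ z ∈ Z, s * col z ∈ Ideal.span {G₁})
    (hirr : W.HasIrreducibleModPGaloisRep p) {L G₁ : IwasawaAlgebra p}
    (hL : IsSignedPAdicLFunction f p ε L)
    (hG₁ : iwasawaToPowerSeries p G₁ = PowerSeries.C ((ϖ : ℚ) : ℚ_[p]) * iwasawaToPowerSeries p L)
    (hG₁0 : G₁ ≠ 0) (𝔭 : PrimeSpectrum (IwasawaAlgebra p)) (h𝔭 : 𝔭.asIdeal.height = 1) :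
    ∃ z ∈ Z, col z ≠ 0 := by
  obtain ⟨s, hs, hsG, -⟩ := himage hirr L G₁ hL hG₁ 𝔭 h𝔭
  obtain ⟨z, hz, hzs⟩ := Submodule.mem_map.mp hsG
  refine ⟨z, hz, ?_⟩
  rw [hzs]
  have hs0 : s ≠ 0 := fun h ↦ hs (h ▸ 𝔭.asIdeal.zero_mem)
  exact mul_ne_zero hs0 hG₁0

omit [Module.Free ℤ_[p] (W.tateModule p)] [Module.Finite ℤ_[p] (W.tateModule p)] in
/-- **The package's image clause from the VALUE form of Thm. 6.3 with Kato Thm. 12.6** at a pin: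
if, whenever `E[p]` is irreducible (Thm. 5.2 iv) / Remark 5.3 i): `Z(T) ⊆ 𝐇¹(T)`), there is a
submodule `Zbig ≤ 𝐇¹_Γ` («`Z(T)^Δ = Λz⁺ + Λz⁻` projected») containing `Z` with `Zbig/Z` finite (Kato
Thm. 12.6) and `col(Zbig) = (G₁)` for the Néron-normalised Pollack function `G₁` of sign `ε`
(Thm. 6.3 at `η = 1`: `Col^ε(z⁺) = L_p^ε(E, X)`; the `Δ`-trivial projection of `z⁻` has vanishing
even-character values, Thm. 5.2 i)), then the localized image clause `image_zeta_localized` of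
`SignedColemanKatoData` holds for `(col, Z)`. [cite: Kobayashi2003, Thm. 6.3 (p. 11), Thm. 5.2 i)/iv) (p. 9), Remark 5.3 i) (p. 10)]
[cite: Kato2004Asterisque, Thm. 12.6 (p. 222)] -/
theorem image_zeta_localized_of_valueForm (I : Kato2004.IwasawaH1Data W p κ γ)
    (col : I.H →ₗ[IwasawaAlgebra p] IwasawaAlgebra p) (Z : Submodule (IwasawaAlgebra p) I.H)
    (hval : W.HasIrreducibleModPGaloisRep p →
      ∃ Zbig : Submodule (IwasawaAlgebra p) I.H, Z ≤ Zbig ∧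
        Finite (Zbig ⧸ Submodule.comap Zbig.subtype Z) ∧
        ∀ (L G₁ : IwasawaAlgebra p), IsSignedPAdicLFunction f p ε L →
          iwasawaToPowerSeries p G₁ = PowerSeries.C ((ϖ : ℚ) : ℚ_[p]) * iwasawaToPowerSeries p L →
          Submodule.map col Zbig = Ideal.span {G₁}) :
    W.HasIrreducibleModPGaloisRep p →
      ∀ (L G₁ : IwasawaAlgebra p), IsSignedPAdicLFunction f p ε L →
        iwasawaToPowerSeries p G₁ = PowerSeries.C ((ϖ : ℚ) : ℚ_[p]) * iwasawaToPowerSeries p L →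
        ∀ 𝔭 : PrimeSpectrum (IwasawaAlgebra p), 𝔭.asIdeal.height = 1 →
          ∃ s : IwasawaAlgebra p, s ∉ 𝔭.asIdeal ∧
            s * G₁ ∈ Submodule.map col Z ∧
            ∀ z ∈ Z, s * col z ∈ Ideal.span {G₁} := by
  intro hirr L G₁ hL hG₁ 𝔭 h𝔭
  obtain ⟨Zbig, hle, hfin, hv⟩ := hval hirr
  exact image_localized_of_map_eq_span col hle hfin (hv L G₁ hL hG₁) 𝔭 h𝔭

/-- **Kobayashi's `η = 1` Coleman–Kato package at ONE pin from the VALUE form** — as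
`nonempty_signedColemanKatoData_of_oneDatum`, with the localized image clause REPLACED by its printed
source: under `Irr(E[p])` a submodule `Zbig` (`Z(T)^Δ`) with `Z ≤ Zbig`, `Zbig/Z` finite (Kato Thm.
12.6) and `col(Zbig) = (G₁)` (Thm. 6.3 at `η = 1`). [cite: Kobayashi2003, proof of Thm. 7.3 i) (p. 13); Thm. 6.3 (p. 11); Thm. 5.2 iv) (p. 9); (7.20), Prop. 7.1 i) (p. 12)]
[cite: Kato2004Asterisque, Thm. 12.4 (2) (p. 221), Thm. 12.6 (p. 222), Ex. 13.3 (p. 225)] -/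
theorem nonempty_signedColemanKatoData_of_valueForm (hγ : κ.IsTopGenerator γ)
    (I : Kato2004.IwasawaH1Data W p κ γ) (hrank : Module.rank (IwasawaAlgebra p) I.H ≤ 1)
    (col : I.H →ₗ[IwasawaAlgebra p] IwasawaAlgebra p) (Z : Submodule (IwasawaAlgebra p) I.H)
    (hne : ∃ z ∈ Z, col z ≠ 0)
    (hspan : Z ≤ Submodule.span (IwasawaAlgebra p) {s : I.H | Kato2004.IsEulerSystemClass W p κ γ I s})
    (hval : W.HasIrreducibleModPGaloisRep p →
      ∃ Zbig : Submodule (IwasawaAlgebra p) I.H, Z ≤ Zbig ∧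
        Finite (Zbig ⧸ Submodule.comap Zbig.subtype Z) ∧
        ∀ (L G₁ : IwasawaAlgebra p), IsSignedPAdicLFunction f p ε L →
          iwasawaToPowerSeries p G₁ = PowerSeries.C ((ϖ : ℚ) : ℚ_[p]) * iwasawaToPowerSeries p L →
          Submodule.map col Zbig = Ideal.span {G₁})
    (D₀ : SignedSelmerDualData W κ γ ε) (Y₀ : W.FineSelmerDualData κ γ)
    (j₀ : IwasawaAlgebra p →ₗ[IwasawaAlgebra p] D₀.X) (k₀ : D₀.X →ₗ[IwasawaAlgebra p] Y₀.X)
    (h₁ : Function.Exact col j₀) (h₂ : Function.Exact j₀ k₀) (h₃ : Function.Surjective k₀) :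
    Nonempty (SignedColemanKatoData W p f ϖ κ γ ε I) :=
  nonempty_signedColemanKatoData_of_oneDatum hγ I hrank col Z hne hspan
    (image_zeta_localized_of_valueForm I col Z hval) D₀ Y₀ j₀ k₀ h₁ h₂ h₃

end Pin

/-! ## §3 Fact level: the package from `Kato2004.thm12_4` and the displayed print-shaped input -/

/-- **Kobayashi 2003, Thm. 6.2 + 6.3 + 7.3 i) at `η = 1` with Kato Thm. 12.6 — the package fact
`thm62_63_73_signedColemanKato_zeta` DERIVED from Kato's Thm. 12.4 (the tree's named fact
`Kato2004.thm12_4`; only the clause `rank_Λ 𝐇¹_Γ(T_pW) = 1` is used, torsion-freeness being the tree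
theorem `IwasawaH1Data.noZeroSMulDivisors`) and the displayed input `hIn`: on the frame of the package
(globally minimal `W`, odd good `p` with `a_p = 0`, newform `f` with period ratio `ϖ`, cyclotomic
`(κ, γ)` matching the variable, sign `ε`, pin `I`) there are a `Λ`-linear `col : 𝐇¹ → Λ` and a
submodule `Z ≤ 𝐇¹` with — VERBATIM the package's clauses — `Z` inside the span of genuine Euler-system
classes (Kato Thm. 12.6 / Ex. 13.3) and the localized image identity `col(Z)_𝔭 = (L_p^ε)_𝔭` at every
height-one `𝔭` under `Irr(E[p])` (Thm. 6.3 on ideals), TOGETHER WITH (a) the printed nonvanishing «some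
`z ∈ Z` has `col z ≠ 0`» (Thm. 6.3 with Rohrlich [20]) IN PLACE OF injectivity, and (b) the exact
sequence `𝐇¹ →^{col} Λ → X^ε → X₀ → 0` ((7.20) with Prop. 7.1 i) and (6.13)/(6.14)) for ONE pair of
dual data `(D₀, Y₀)` IN PLACE OF all pairs.** The two replaced clauses are recovered by
`nonempty_signedColemanKatoData_of_oneDatum` (Thm. 7.3 i)'s printed inference and transport). An `_of_`
edge, not a `_holds`: `hIn` is what remains to be formalised from print (module docstring §«Residual
inputs»: local signed Coleman map onto `Λ`, localisation pairing, Poitou–Tate along the tower, explicit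
reciprocity); the package itself is not assumed in any form.
[cite: Kobayashi2003, Thm. 7.3 i) (7.21) and its proof (p. 13); Thm. 6.2 (6.13)–(6.14), Thm. 6.3 (p. 11); (7.20), Prop. 7.1 i) (p. 12); Thm. 5.1 ii)/iii), Thm. 5.2 iv), Remark 5.3 i) (pp. 9–10)]
[cite: Kato2004Asterisque, Thm. 12.4 (2) (p. 221), Thm. 12.6 (p. 222), Ex. 13.3 (p. 225)] -/
theorem thm62_63_73_signedColemanKato_zeta_of_inputs (h124 : Kato2004.thm12_4)
    (hIn : ∀ (W : WeierstrassCurve ℚ) [W.IsElliptic] [W.IsGloballyMinimal] (p : ℕ) [Fact p.Prime]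
      [ContinuousSMul ℤ_[p] (W.tateModule p)] [Module.Free ℤ_[p] (W.tateModule p)]
      [Module.Finite ℤ_[p] (W.tateModule p)] {N : ℕ} [NeZero N] (f : CuspForm (Gamma0 N) 2) (ϖ : ℚ)
      (κ : ZpExtension ℚ p) (γ : absoluteGaloisGroup ℚ),
      p ≠ 2 → W.HasGoodReductionAtPrime p → W.frobeniusTrace p = 0 → IsNewformOf W f →
      (ϖ : ℝ) * W.realPeriodRat = plusPeriod f →
      κ.IsCyclotomic → κ.IsTopGenerator γ → IsCyclotomicVariable p γ →
      ∀ (ε : ℤˣ) (I : Kato2004.IwasawaH1Data W p κ γ),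
        ∃ (col : I.H →ₗ[IwasawaAlgebra p] IwasawaAlgebra p) (Z : Submodule (IwasawaAlgebra p) I.H),
          (∃ z ∈ Z, col z ≠ 0) ∧
          Z ≤ Submodule.span (IwasawaAlgebra p) {s : I.H | Kato2004.IsEulerSystemClass W p κ γ I s} ∧
          (W.HasIrreducibleModPGaloisRep p →
            ∀ (L G₁ : IwasawaAlgebra p), IsSignedPAdicLFunction f p ε L →
              iwasawaToPowerSeries p G₁ = PowerSeries.C ((ϖ : ℚ) : ℚ_[p]) * iwasawaToPowerSeries p L →
              ∀ 𝔭 : PrimeSpectrum (IwasawaAlgebra p), 𝔭.asIdeal.height = 1 →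
                ∃ s : IwasawaAlgebra p, s ∉ 𝔭.asIdeal ∧
                  s * G₁ ∈ Submodule.map col Z ∧
                  ∀ z ∈ Z, s * col z ∈ Ideal.span {G₁}) ∧
          ∃ (D₀ : SignedSelmerDualData W κ γ ε) (Y₀ : W.FineSelmerDualData κ γ)
            (j₀ : IwasawaAlgebra p →ₗ[IwasawaAlgebra p] D₀.X) (k₀ : D₀.X →ₗ[IwasawaAlgebra p] Y₀.X),
            Function.Exact col j₀ ∧ Function.Exact j₀ k₀ ∧ Function.Surjective k₀) :
    thm62_63_73_signedColemanKato_zeta := by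
  intro W _ _ p _ _ _ _ N _ f ϖ κ γ hp hgood hap hf hϖ hκ hγ hγ' ε I
  obtain ⟨col, Z, hne, hspan, himage, D₀, Y₀, j₀, k₀, h₁, h₂, h₃⟩ :=
    hIn W p f ϖ κ γ hp hgood hap hf hϖ hκ hγ hγ' ε I
  obtain ⟨-, ⟨-, hrk⟩, -⟩ := h124 W p κ γ hκ hγ I
  exact nonempty_signedColemanKatoData_of_oneDatum hγ I hrk.le col Z hne hspan himage D₀ Y₀ j₀ k₀ h₁ h₂ h₃

/-- **The package from `Kato2004.thm12_4` and the VALUE-form input** — as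
`thm62_63_73_signedColemanKato_zeta_of_inputs`, with the localized image clause of `hIn` REPLACED by
its printed source (Thm. 6.3 at `η = 1` as an equality of ideals `col(Z(T)^Δ) = (L_p^ε(E, X))` on a
submodule `Zbig = Z(T)^Δ ≥ Z` of finite index, Kato Thm. 12.6, under `Irr(E[p])`, Thm. 5.2 iv)). The
displayed `hVal` is then, clause by clause: «`Col^ε ∘ loc_p`» exists as a `Λ`-linear map (Thm. 6.2
(6.13)/(6.14) with the localisation), it does not vanish on Kato's `Z` (Thm. 6.3 with Rohrlich [20]),
`Z` lies in the span of genuine Euler-system classes (Kato Thm. 12.6 / Ex. 13.3), the value identity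
with finite index (Thm. 6.3 / Kato Thm. 12.6), and (7.20) with Prop. 7.1 i) for ONE pair of dual data.
[cite: Kobayashi2003, Thm. 7.3 i) and its proof (p. 13); Thm. 6.2 (6.13)–(6.14), Thm. 6.3 (p. 11); (7.20), Prop. 7.1 i) (p. 12); Thm. 5.2 iv), Remark 5.3 i) (pp. 9–10)]
[cite: Kato2004Asterisque, Thm. 12.4 (2) (p. 221), Thm. 12.6 (p. 222), Ex. 13.3 (p. 225)] -/
theorem thm62_63_73_signedColemanKato_zeta_of_valueInputs (h124 : Kato2004.thm12_4)
    (hVal : ∀ (W : WeierstrassCurve ℚ) [W.IsElliptic] [W.IsGloballyMinimal] (p : ℕ) [Fact p.Prime]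
      [ContinuousSMul ℤ_[p] (W.tateModule p)] [Module.Free ℤ_[p] (W.tateModule p)]
      [Module.Finite ℤ_[p] (W.tateModule p)] {N : ℕ} [NeZero N] (f : CuspForm (Gamma0 N) 2) (ϖ : ℚ)
      (κ : ZpExtension ℚ p) (γ : absoluteGaloisGroup ℚ),
      p ≠ 2 → W.HasGoodReductionAtPrime p → W.frobeniusTrace p = 0 → IsNewformOf W f →
      (ϖ : ℝ) * W.realPeriodRat = plusPeriod f →
      κ.IsCyclotomic → κ.IsTopGenerator γ → IsCyclotomicVariable p γ →
      ∀ (ε : ℤˣ) (I : Kato2004.IwasawaH1Data W p κ γ),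
        ∃ (col : I.H →ₗ[IwasawaAlgebra p] IwasawaAlgebra p) (Z : Submodule (IwasawaAlgebra p) I.H),
          (∃ z ∈ Z, col z ≠ 0) ∧
          Z ≤ Submodule.span (IwasawaAlgebra p) {s : I.H | Kato2004.IsEulerSystemClass W p κ γ I s} ∧
          (W.HasIrreducibleModPGaloisRep p →
            ∃ Zbig : Submodule (IwasawaAlgebra p) I.H, Z ≤ Zbig ∧
              Finite (Zbig ⧸ Submodule.comap Zbig.subtype Z) ∧
              ∀ (L G₁ : IwasawaAlgebra p), IsSignedPAdicLFunction f p ε L →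
                iwasawaToPowerSeries p G₁ = PowerSeries.C ((ϖ : ℚ) : ℚ_[p]) * iwasawaToPowerSeries p L →
                Submodule.map col Zbig = Ideal.span {G₁}) ∧
          ∃ (D₀ : SignedSelmerDualData W κ γ ε) (Y₀ : W.FineSelmerDualData κ γ)
            (j₀ : IwasawaAlgebra p →ₗ[IwasawaAlgebra p] D₀.X) (k₀ : D₀.X →ₗ[IwasawaAlgebra p] Y₀.X),
            Function.Exact col j₀ ∧ Function.Exact j₀ k₀ ∧ Function.Surjective k₀) :
    thm62_63_73_signedColemanKato_zeta := by
  intro W _ _ p _ _ _ _ N _ f ϖ κ γ hp hgood hap hf hϖ hκ hγ hγ' ε I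
  obtain ⟨col, Z, hne, hspan, hval, D₀, Y₀, j₀, k₀, h₁, h₂, h₃⟩ :=
    hVal W p f ϖ κ γ hp hgood hap hf hϖ hκ hγ hγ' ε I
  obtain ⟨-, ⟨-, hrk⟩, -⟩ := h124 W p κ γ hκ hγ I
  exact nonempty_signedColemanKatoData_of_valueForm hγ I hrk.le col Z hne hspan hval D₀ Y₀ j₀ k₀
    h₁ h₂ h₃

/-! ## §4 The nonvanishing clause discharged: Pollack's `L_p^ε ≠ 0` (tree theorem) and the period-unit
facts make «some `z ∈ Z` has `col z ≠ 0`» a CONSEQUENCE of the value form -/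

section Nonvanishing

/-- A non-zero rational of `p`-adic valuation `0` is (the image of) a unit of `ℤ_p`. [folklore] -/
private theorem exists_units_coe_eq_ratCast {p : ℕ} [Fact p.Prime] {ϖ : ℚ} (hϖ0 : ϖ ≠ 0)
    (hv : padicValRat p ϖ = 0) : ∃ u : ℤ_[p]ˣ, ((u : ℤ_[p]) : ℚ_[p]) = (ϖ : ℚ_[p]) := by
  have hne : ((ϖ : ℚ) : ℚ_[p]) ≠ 0 := by exact_mod_cast hϖ0
  have hnorm : ‖((ϖ : ℚ) : ℚ_[p])‖ = 1 := by
    rw [Padic.norm_eq_zpow_neg_valuation hne, Padic.valuation_ratCast, hv, neg_zero, zpow_zero]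
  exact ⟨PadicInt.mkUnits hnorm, PadicInt.mkUnits_eq hnorm⟩

/-- `ι : Λ → ℚ_p⟦T⟧` commutes with rescaling by a unit constant `C u`. [folklore] -/
private theorem iwasawaToPowerSeries_C_units_mul {p : ℕ} [Fact p.Prime] (u : ℤ_[p]ˣ)
    (L : IwasawaAlgebra p) :
    iwasawaToPowerSeries p (PowerSeries.C (u : ℤ_[p]) * L) =
      PowerSeries.C ((u : ℤ_[p]) : ℚ_[p]) * iwasawaToPowerSeries p L := by
  rw [map_mul]
  congr 1
  rw [iwasawaToPowerSeries, PowerSeries.map_C]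
  rfl

/-- **The package from `Kato2004.thm12_4`, the two period-unit facts and the VALUE-form input WITHOUT a
nonvanishing clause.** On the frame of the package, `E[p]` is irreducible (`p` odd supersingular:
Remark 5.3 i), tree theorem `hasIrreducibleModPGaloisRep_of_dvd_frobeniusTrace`), Pollack's `L_p^ε`
exists and is non-zero (Rohrlich [20] / Pollack Cor. 5.11, tree theorem
`exists_ne_zero_and_isSignedPAdicLFunction`), and the period ratio `ϖ` is a `p`-adic unit
(Greenberg–Vatsal 2000 §3 / Mazur 1978: the named facts `realPeriodRat_eq_unit_mul_plusPeriod` (`p ≥ 5`)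
and `…_three` (`p = 3`), via `Rank1Residual.padicValRat_periodRatio_eq_zero` — the SAME two facts the
19002 consumer `signedMu_eq_zero_of_hasUnitContent` already carries as `h5`, `h3`), so an INTEGRAL
Néron-normalised `G₁ = C(u)·L ≠ 0` with `ι G₁ = C(ϖ)·ι L` exists; the value identity `col(Zbig) = (G₁)`
then yields `z ∈ Z` with `col z ≠ 0` at the height-one prime `(p)`
(`exists_mem_ne_zero_of_image_zeta_localized`). Hence the residual input `hVal'` has exactly FOUR printed
clauses: «`Col^ε ∘ loc_p`» as a `Λ`-linear map (Thm. 6.2 (6.13)/(6.14) with the localisation), `Z` in the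
span of genuine Euler-system classes (Kato Thm. 12.6 / Ex. 13.3), the value identity with finite index
under `Irr(E[p])` (Thm. 6.3 / Thm. 5.2 iv) / Kato Thm. 12.6), and (7.20) with Prop. 7.1 i) for ONE pair
of dual data. [cite: Kobayashi2003, Thm. 7.3 i) and its proof (p. 13); Thm. 6.2 (6.13)–(6.14), Thm. 6.3 (p. 11); (7.20), Prop. 7.1 i) (p. 12); Thm. 5.2 iv), Remark 5.3 i) (pp. 9–10); Thm. 3.2 (p. 7)]
[cite: Kato2004Asterisque, Thm. 12.4 (2) (p. 221), Thm. 12.6 (p. 222), Ex. 13.3 (p. 225)]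
[cite: GreenbergVatsal2000, §3, Remark 3.4] [cite: Pollack2003, Cor. 5.11] -/
theorem thm62_63_73_signedColemanKato_zeta_of_valueInputs_of_periodUnit (h124 : Kato2004.thm12_4)
    (h5 : realPeriodRat_eq_unit_mul_plusPeriod) (h3 : realPeriodRat_eq_unit_mul_plusPeriod_three)
    (hVal' : ∀ (W : WeierstrassCurve ℚ) [W.IsElliptic] [W.IsGloballyMinimal] (p : ℕ) [Fact p.Prime]
      [ContinuousSMul ℤ_[p] (W.tateModule p)] [Module.Free ℤ_[p] (W.tateModule p)]
      [Module.Finite ℤ_[p] (W.tateModule p)] {N : ℕ} [NeZero N] (f : CuspForm (Gamma0 N) 2) (ϖ : ℚ)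
      (κ : ZpExtension ℚ p) (γ : absoluteGaloisGroup ℚ),
      p ≠ 2 → W.HasGoodReductionAtPrime p → W.frobeniusTrace p = 0 → IsNewformOf W f →
      (ϖ : ℝ) * W.realPeriodRat = plusPeriod f →
      κ.IsCyclotomic → κ.IsTopGenerator γ → IsCyclotomicVariable p γ →
      ∀ (ε : ℤˣ) (I : Kato2004.IwasawaH1Data W p κ γ),
        ∃ (col : I.H →ₗ[IwasawaAlgebra p] IwasawaAlgebra p) (Z : Submodule (IwasawaAlgebra p) I.H),
          Z ≤ Submodule.span (IwasawaAlgebra p) {s : I.H | Kato2004.IsEulerSystemClass W p κ γ I s} ∧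
          (W.HasIrreducibleModPGaloisRep p →
            ∃ Zbig : Submodule (IwasawaAlgebra p) I.H, Z ≤ Zbig ∧
              Finite (Zbig ⧸ Submodule.comap Zbig.subtype Z) ∧
              ∀ (L G₁ : IwasawaAlgebra p), IsSignedPAdicLFunction f p ε L →
                iwasawaToPowerSeries p G₁ = PowerSeries.C ((ϖ : ℚ) : ℚ_[p]) * iwasawaToPowerSeries p L →
                Submodule.map col Zbig = Ideal.span {G₁}) ∧
          ∃ (D₀ : SignedSelmerDualData W κ γ ε) (Y₀ : W.FineSelmerDualData κ γ)
            (j₀ : IwasawaAlgebra p →ₗ[IwasawaAlgebra p] D₀.X) (k₀ : D₀.X →ₗ[IwasawaAlgebra p] Y₀.X),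
            Function.Exact col j₀ ∧ Function.Exact j₀ k₀ ∧ Function.Surjective k₀) :
    thm62_63_73_signedColemanKato_zeta := by
  intro W _ _ p _ _ _ _ N _ f ϖ κ γ hp hgood hap hf hϖ hκ hγ hγ' ε I
  obtain ⟨col, Z, hspan, hval, D₀, Y₀, j₀, k₀, h₁, h₂, h₃⟩ :=
    hVal' W p f ϖ κ γ hp hgood hap hf hϖ hκ hγ hγ' ε I
  obtain ⟨-, ⟨-, hrk⟩, -⟩ := h124 W p κ γ hκ hγ I
  -- `p` odd supersingular ⟹ `E[p]` irreducible (Remark 5.3 i))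
  have hirr : W.HasIrreducibleModPGaloisRep p :=
    hasIrreducibleModPGaloisRep_of_dvd_frobeniusTrace W p hp
      (W.not_dvd_minimalDiscriminantInt_of_hasGoodReductionAtPrime' p hgood)
      (by rw [hap]; exact dvd_zero _)
  -- Pollack's `L_p^ε`, non-zero (Rohrlich)
  obtain ⟨L, hL0, hL⟩ := exists_ne_zero_and_isSignedPAdicLFunction hp hf hgood hap ε
  -- the period ratio is a `p`-adic unit: `ϖ = u`, and `G₁ := C(u)·L` is the Néron-normalised `L_p^ε ∈ Λ`
  have hvϖ : padicValRat p ϖ = 0 :=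
    Rank1Residual.padicValRat_periodRatio_eq_zero h5 h3 W p hp hgood hirr f hf ϖ hϖ
  have hϖ0 : ϖ ≠ 0 := by
    intro hz
    rw [hz, Rat.cast_zero, zero_mul] at hϖ
    exact (IsNewform0.plusPeriod_pos_holds hf.1 hf.coeffField_eq_bot).ne' hϖ.symm
  obtain ⟨u, hu⟩ := exists_units_coe_eq_ratCast hϖ0 hvϖ
  have hG₁ : iwasawaToPowerSeries p (PowerSeries.C (u : ℤ_[p]) * L) =
      PowerSeries.C ((ϖ : ℚ) : ℚ_[p]) * iwasawaToPowerSeries p L := by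
    rw [iwasawaToPowerSeries_C_units_mul, hu]
  have hG₁0 : PowerSeries.C (u : ℤ_[p]) * L ≠ 0 :=
    mul_ne_zero ((Units.isUnit u).map PowerSeries.C).ne_zero hL0
  -- the localized image clause from the value form, and nonvanishing at `𝔭 = (p)`
  have himage := image_zeta_localized_of_valueForm (f := f) (ϖ := ϖ) (ε := ε) I col Z hval
  let 𝔭 : PrimeSpectrum (IwasawaAlgebra p) :=
    ⟨IwasawaAlgebra.augIdealP p, IwasawaAlgebra.isPrime_augIdealP_holds p⟩
  have hne : ∃ z ∈ Z, col z ≠ 0 :=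
    exists_mem_ne_zero_of_image_zeta_localized I col Z himage hirr hL hG₁ hG₁0 𝔭
      (by exact IwasawaAlgebra.height_augIdealP_holds p)
  exact nonempty_signedColemanKatoData_of_oneDatum hγ I hrk.le col Z hne hspan himage D₀ Y₀ j₀ k₀
    h₁ h₂ h₃

end Nonvanishing

end Literature.NumberTheory.EllipticCurves.Kobayashi2003

end
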